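import Summits.Schanuel.Schanuel.Theorems.DiophantineDichotomyKhovanskiiApproxTypeEvSyncDiazSlot
import Summits.Schanuel.Schanuel.Theorems.DiophantineDichotomyKhovanskiiApproxTypeEvFinrankRange
import Summits.Schanuel.Schanuel.Theorems.DiophantineDichotomyKhovanskiiApproxTypeEvPairSumMeasure
import HarnessLib

/-!
# The Dirichlet floor `a ≥ 1/n` at EVERY Lindemann–Weierstrass point (`stub_lwSynchronisedFloor`)
# — crux `DiophantineDichotomy.KhovanskiiApproxTypeEv` (stmt-Schanuel-14972), line `Sketch`, sub-goal I

Line `Sketch` of crux `Summit.Schanuel.Schanuel.Theses.DiophantineDichotomy.KhovanskiiApproxTypeEv`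
(stmt-Schanuel-14972), skeleton v14 (lead `prover-line-stmt-Schanuel-14972-c14-0`), registered stub
`stub_lwSynchronisedFloor` (sub-goal I) — `--supports stmt-Schanuel-14972`.

The crux asks, at every free Khovanskii point `θ = (s, e^s) ∈ ℂ²ⁿ`, for an eventual approximation type
`(a, b, C)` with `a < 1/(n−1)` (`ApproxTypeEvAt n s a b C`); its naive Lindemann–Weierstrass layer at rank `n`
is `EvLW n` (leaf B of the typed split, open for `n ≥ 3`).  The route text has "expected truth `a = 1/n`";
the cdisprove file (`Cruxes/KhovanskiiApproxTypeEv/Disproof.lean` §(c), §(e)) kernel-checked the floor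
`a ≥ 1/2` at `n = 2` by a complex-conjugation trick, left `floor_third_at_lw_three` sorried ("needs AP(3) or
synchronised Wirsing") and recorded "two independent Diaz approximants in one challenger cannot be
height-synchronised … hence no unconditional floor at `n ≥ 3`".  THIS FILE PROVES THE FLOOR `a ≥ 1/n` AT
EVERY LW POINT OF EVERY RANK, unconditionally: the synchronisation is supplied by the landed sub-goal H
`stub_syncDiazSlot` (`…EvSyncDiazSlot.lean`: Diaz's theorem `Bugeaud2004_thm_8_11_holds`, which holds at EVERY
scale `M`, combined with the linear-in-the-degree clause measure of `e^β`, `stub_expAlgIrredClauseMeasure`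
p148854 from Ably 1994 PROVED, which forces Diaz's approximant to have degree `≥ 0.003 m / C_β`, hence quality
`exp(−q_β m log M)` uniformly in `M`).  Running H in each of the `n` slots `e^{s₁}, …, e^{sₙ}` at ONE common
scale `M` gives the challenger `γ = (s, α₁, …, αₙ)`: common field `ℚ(s, α)` of degree `≤ F_s mⁿ`
(`stub_finrankAdjoinRangeLe`), level `(F_s mⁿ, H)` with `log H ≤ log H₁ + log n + m log 2 + log M`, distance
`≤ exp(−q m log M)` with `q = minᵢ qᵢ` — exponent `≍ d^{1/n} log H`; for `a < 1/n` some `m ≥ 50` has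
`C (F_s mⁿ)^{max(a,0)} ≤ (q/2) m` (`exists_deg`) and `log M → ∞` beats `exp(−C(dᵃ log H + dᵇ))`.

Consequences (sorry-free, below): `approxTypeEvAt_lw_exponent_ge` (pointwise window lower end `1/n`),
`evLW_window_rank` (leaf B's window at rank `n` is `[1/n, 1/(n−1))` — `evLWDh` p137028 PROVES `1/n` from above
in `(d, h_abs)` currency, so the naive-vs-`(d,h)` gap of STRATEGY-CENSUS §6 R3 is now pinned from both sides),
`not_evLW_sharp_of_point` / `not_evLW_sharp` (the sharp layer `a < 1/n` fails at EVERY rank: an LW point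
of rank `n` is `n` powers of a primitive `p`-th root of unity, `exists_algebraic_linearIndependent`),
`not_khovanskiiApproxTypeEv_sharp_rank` (the crux with `a < 1/n` fails at every rank `n`, not only via `n = 2`).
Everything is proved; no named facts.
-/

noncomputable section

set_option linter.dupNamespace false

namespace Summit.Schanuel.Schanuel.Cruxes.KhovanskiiApproxTypeEv.AnchoredReduction

open Summit.Schanuel.Schanuel.Cruxes.KhovanskiiApproxType.Negative
  (natHeight abs_coeff_le_natHeight natHeight_le exists_deg)
open Polynomial

set_option maxHeartbeats 1600000 in
/-- **SUB-GOAL I — the Dirichlet floor `a ≥ 1/n` at every Lindemann–Weierstrass point of every rank `n ≥ 1`.**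
For algebraic non-zero `s₁, …, sₙ` there is no eventual approximation type `(a, b, C)` with `a < 1/n` at
`θ = (s, e^{s})`: `n` synchronised Diaz slots (sub-goal H) at ONE common scale `M` give challengers
`γ = (s, α₁, …, αₙ)` in the common field `ℚ(s, α₁, …, αₙ)` of degree `≤ F_s mⁿ`, admissible at level
`(F_s mⁿ, H)` with `log H ≤ log H₁ + log n + m log 2 + log M`, at distance `≤ exp(−q m log M)` from `θ`;
since `n·max(a,0) < 1`, some `m ≥ 50` has `C (F_s mⁿ)^{max(a,0)} ≤ (q/2) m`, and then `log M` large beats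
`exp(−C(dᵃ log H + dᵇ))`. [cite: Bugeaud2004, Thm 8.11] -/
theorem stub_lwSynchronisedFloor : ∀ (n : ℕ) (s : Fin n → ℂ) (a b C : ℝ), 1 ≤ n →
    (∀ i, IsAlgebraic ℚ (s i)) → (∀ i, s i ≠ 0) → a < 1 / (n : ℝ) → ¬ ApproxTypeEvAt n s a b C := by
  intro n s a b C hn halg hs0 ha
  rintro ⟨hC, hall⟩
  haveI : Nonempty (Fin n) := ⟨⟨0, hn⟩⟩
  have hnr : (1 : ℝ) ≤ n := by exact_mod_cast hn
  have hnpos : (0 : ℝ) < n := by linarith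
  -- nonnegative exponents dominate
  set a' : ℝ := max a 0 with ha'
  set b' : ℝ := max b 0 with hb'
  have ha'lt : a' < 1 / (n : ℝ) := max_lt ha (by positivity)
  set e : ℝ := (n : ℝ) * a' with hedef
  have he1 : e < 1 := by
    have h := (lt_div_iff₀ hnpos).mp ha'lt
    rw [hedef]; linarith [mul_comm (n : ℝ) a']
  -- the synchronised Diaz slots (sub-goal H), one quality constant per slot; `q₀` the least
  choose q hq0 hq using fun i => stub_syncDiazSlot (s i) (halg i) (hs0 i)
  obtain ⟨i₀, -, hi₀⟩ := Finset.exists_min_image Finset.univ q Finset.univ_nonempty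
  set q₀ : ℝ := q i₀ with hq₀def
  have hq₀pos : 0 < q₀ := hq0 i₀
  have hq₀le : ∀ i, q₀ ≤ q i := fun i => hi₀ i (Finset.mem_univ i)
  -- fixed clauses of the algebraic coordinates `sᵢ`
  choose T B hT0 hTB hTroot using fun i => exists_intPoly_bound_of_isAlgebraic (halg i)
  have hT1 : ∀ i, 1 ≤ (T i).natDegree := fun i =>
    one_le_budget_of_clause ⟨T i, hT0 i, le_rfl, hTB i, hTroot i⟩
  set F : ℕ := ∏ i, (T i).natDegree with hFdef
  have hFpos : 0 < F := by
    rw [hFdef]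
    exact Finset.prod_pos fun i _ => hT1 i
  have hF1 : 1 ≤ F := hFpos
  have hTF : ∀ i, (T i).natDegree ≤ F := fun i =>
    Nat.le_of_dvd hF1 (Finset.dvd_prod_of_mem (fun j => (T j).natDegree) (Finset.mem_univ i))
  set Bs : ℕ := ∑ i, B i with hBsdef
  have hBBs : ∀ i, B i ≤ Bs := fun i =>
    Finset.single_le_sum (fun j _ => Nat.zero_le (B j)) (Finset.mem_univ i)
  -- the choice of the Diaz degree `m`: `C (F mⁿ)^{a'} ≤ (q₀/2) m`
  set C' : ℝ := C * (F : ℝ) ^ a' * (3 / 1000 / (q₀ / 2)) with hC'def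
  have hC'pos : 0 < C' := by positivity
  obtain ⟨m, hm50, hm⟩ := exists_deg e C' he1 hC'pos
  have hm1nat : 1 ≤ m := le_trans (by norm_num) hm50
  have hm1 : (1 : ℝ) ≤ m := by exact_mod_cast hm1nat
  have hmpos : (0 : ℝ) < m := by linarith
  have hkey_m : C * (F : ℝ) ^ a' * (m : ℝ) ^ e ≤ q₀ / 2 * m := by
    have hk : (0 : ℝ) < 3 / 1000 / (q₀ / 2) := by positivity
    have h1 : C * (F : ℝ) ^ a' * (m : ℝ) ^ e * (3 / 1000 / (q₀ / 2)) ≤ 3 / 1000 * m := by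
      calc C * (F : ℝ) ^ a' * (m : ℝ) ^ e * (3 / 1000 / (q₀ / 2)) = C' * (m : ℝ) ^ e := by
            rw [hC'def]; ring
        _ ≤ 3 / 1000 * m := hm
    have h2 := (le_div_iff₀ hk).mpr h1
    have h3 : 3 / 1000 * (m : ℝ) / (3 / 1000 / (q₀ / 2)) = q₀ / 2 * m := by
      field_simp
    linarith [h2, h3.le, h3.ge]
  -- the budget `d = F mⁿ`
  set d : ℕ := F * m ^ n with hddef
  have hdcast : (d : ℝ) = (F : ℝ) * (m : ℝ) ^ n := by rw [hddef]; push_cast; ring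
  have hmn : m ≤ m ^ n := by
    calc m = m ^ 1 := (pow_one m).symm
      _ ≤ m ^ n := Nat.pow_le_pow_right hm1nat hn
  have hmd : m ≤ d := by rw [hddef]; exact le_trans hmn (Nat.le_mul_of_pos_left _ hF1)
  have hFd : F ≤ d := by rw [hddef]; exact Nat.le_mul_of_pos_right _ (pow_pos hm1nat n)
  have hd1nat : 1 ≤ d := hm1nat.trans hmd
  have hd1 : (1 : ℝ) ≤ d := by exact_mod_cast hd1nat
  have hda' : C * (d : ℝ) ^ a' ≤ q₀ / 2 * m := by
    have h1 : (d : ℝ) ^ a' = (F : ℝ) ^ a' * (m : ℝ) ^ e := by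
      rw [hdcast, Real.mul_rpow (by positivity) (by positivity)]
      congr 1
      rw [← Real.rpow_natCast, ← Real.rpow_mul hmpos.le]
    rw [h1, ← mul_assoc]
    exact hkey_m
  -- the threshold of the eventual form at budget `d`
  obtain ⟨H₀, hH₀⟩ := hall d
  set H₁ : ℕ := max H₀ (max 2 Bs) with hH₁def
  have hH₁2nat : 2 ≤ H₁ := (le_max_left 2 Bs).trans (le_max_right _ _)
  have hBsH₁ : Bs ≤ H₁ := (le_max_right 2 Bs).trans (le_max_right _ _)
  have hH₀H₁ : H₀ ≤ H₁ := le_max_left _ _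
  have hH₁1 : (1 : ℝ) ≤ H₁ := by exact_mod_cast le_trans (by norm_num) hH₁2nat
  have hH₁pos : (0 : ℝ) < H₁ := by linarith
  -- the per-slot scale thresholds at degree `m`, and the common scale `M`
  choose M₀ hM₀ using fun i => hq i m hm50
  set K0 : ℝ := q₀ / 2 * m * (Real.log H₁ + Real.log n + m * Real.log 2) + C * (d : ℝ) ^ b' with hK0def
  set M : ℝ := max (max (∑ i, max (M₀ i) 0) 1) (Real.exp (K0 / (q₀ / 2 * m) + 1)) with hMdef
  have hM₀M : ∀ i, M₀ i ≤ M := fun i => by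
    have h2 : max (M₀ i) 0 ≤ ∑ j, max (M₀ j) 0 :=
      Finset.single_le_sum (fun j _ => le_max_right (M₀ j) 0) (Finset.mem_univ i)
    exact (le_max_left _ _).trans (h2.trans ((le_max_left _ _).trans (le_max_left _ _)))
  have hM1 : (1 : ℝ) ≤ M := (le_max_right _ _).trans (le_max_left _ _)
  have hMpos : 0 < M := by linarith
  have hlogM0 : 0 ≤ Real.log M := Real.log_nonneg hM1
  have hlogM : K0 / (q₀ / 2 * m) + 1 ≤ Real.log M := by
    rw [Real.le_log_iff_exp_le hMpos]
    exact le_max_right _ _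
  -- the `n` Diaz slots at the common scale `M`
  choose α P hPirr hPα hdP hPdeg hPM hdist using fun i => hM₀ i M (hM₀M i)
  have hP0 : ∀ i, P i ≠ 0 := fun i => (hPirr i).ne_zero
  -- the challenger `γ = (s, α)` at level `(d, H)`
  set γ : Fin n ⊕ Fin n → ℂ := Sum.elim s α with hγ
  set Hn : ℕ := ∑ i, natHeight (P i) with hHndef
  set H : ℕ := max H₁ Hn with hHdef
  have hHnH : ∀ i, natHeight (P i) ≤ H := fun i =>
    (Finset.single_le_sum (fun j _ => Nat.zero_le (natHeight (P j))) (Finset.mem_univ i)).trans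
      (le_max_right _ _)
  have hH0le : H₀ ≤ H := hH₀H₁.trans (le_max_left _ _)
  have hH2 : 2 ≤ H := hH₁2nat.trans (le_max_left _ _)
  have hH1r : (1 : ℝ) ≤ H := by exact_mod_cast le_trans (by norm_num) hH2
  have hHpos : (0 : ℝ) < H := by linarith
  have hcl : ∀ i, ∃ Q : Polynomial ℤ, Q ≠ 0 ∧ Q.natDegree ≤ d ∧ (∀ k, |Q.coeff k| ≤ (H : ℤ)) ∧
      Polynomial.aeval (γ i) Q = 0 := by
    rintro (i | i)
    · refine ⟨T i, hT0 i, (hTF i).trans hFd, fun k => (hTB i k).trans ?_, by simpa [hγ] using hTroot i⟩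
      exact_mod_cast (hBBs i).trans (hBsH₁.trans (le_max_left _ _))
    · refine ⟨P i, hP0 i, (hPdeg i).trans hmd, fun k => (abs_coeff_le_natHeight (P i) k).trans ?_,
        by simpa [hγ] using hPα i⟩
      exact_mod_cast hHnH i
  -- the common field `ℚ(s, α₁, …, αₙ)` has degree `≤ F mⁿ = d`
  have hcl' : ∀ i, ∃ Q : Polynomial ℤ, Q ≠ 0 ∧
      Q.natDegree ≤ Sum.elim (fun i => (T i).natDegree) (fun _ => m) i ∧ Polynomial.aeval (γ i) Q = 0 := by
    rintro (i | i)
    · exact ⟨T i, hT0 i, le_rfl, by simpa [hγ] using hTroot i⟩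
    · exact ⟨P i, hP0 i, hPdeg i, by simpa [hγ] using hPα i⟩
  have hfr : Module.finrank ℚ ↥(IntermediateField.adjoin ℚ (Set.range γ)) ≤ d := by
    refine (stub_finrankAdjoinRangeLe γ _ hcl').trans (le_of_eq ?_)
    rw [Fintype.prod_sum_type]
    simp only [Sum.elim_inl, Sum.elim_inr, Finset.prod_const, Finset.card_univ, Fintype.card_fin]
    rw [hddef]
  have key := hH₀ H γ hH0le hfr hcl
  -- the distance: every transcendental slot within `exp(−q₀ m log M)`
  have hmlogM : 0 ≤ (m : ℝ) * Real.log M := by positivity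
  have hdist' : ‖γ - Sum.elim s (Complex.exp ∘ s)‖ ≤ Real.exp (-(q₀ * m * Real.log M)) := by
    refine (pi_norm_le_iff_of_nonneg (Real.exp_nonneg _)).mpr ?_
    rintro (i | i)
    · simp only [hγ, Pi.sub_apply, Sum.elim_inl, sub_self, norm_zero]
      exact Real.exp_nonneg _
    · calc ‖(γ - Sum.elim s (Complex.exp ∘ s)) (Sum.inr i)‖ = ‖Complex.exp (s i) - α i‖ := by
            simp only [hγ, Pi.sub_apply, Sum.elim_inr, Function.comp_apply, norm_sub_rev]
        _ ≤ Real.exp (-(q i * m * Real.log M)) := hdist i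
        _ ≤ Real.exp (-(q₀ * m * Real.log M)) := by
            rw [Real.exp_le_exp]
            have h1 : q₀ * (m * Real.log M) ≤ q i * (m * Real.log M) :=
              mul_le_mul_of_nonneg_right (hq₀le i) hmlogM
            linarith [mul_assoc q₀ (m : ℝ) (Real.log M), mul_assoc (q i) (m : ℝ) (Real.log M)]
  -- height bookkeeping: `log H ≤ log H₁ + log n + m log 2 + log M`
  have hlogH : Real.log H ≤ Real.log H₁ + Real.log n + m * Real.log 2 + Real.log M := by
    have hHn : (Hn : ℝ) ≤ n * (2 ^ m * M) := by
      rw [hHndef]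
      push_cast
      calc ∑ i, (natHeight (P i) : ℝ) ≤ ∑ _i : Fin n, (2 : ℝ) ^ m * M := Finset.sum_le_sum fun i _ => ?_
        _ = n * (2 ^ m * M) := by
            rw [Finset.sum_const, Finset.card_univ, Fintype.card_fin, nsmul_eq_mul]
      calc (natHeight (P i) : ℝ) ≤ 2 ^ (P i).natDegree * ((P i).map (Int.castRingHom ℂ)).mahlerMeasure :=
            natHeight_le _
        _ ≤ 2 ^ m * ((P i).map (Int.castRingHom ℂ)).mahlerMeasure := by
            gcongr
            · exact Polynomial.mahlerMeasure_nonneg _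
            · norm_num
            · exact hPdeg i
        _ ≤ 2 ^ m * M := mul_le_mul_of_nonneg_left (hPM i) (by positivity)
    have h2mM : (1 : ℝ) ≤ 2 ^ m * M := one_le_mul_of_one_le_of_one_le (one_le_pow₀ (by norm_num)) hM1
    have hHle : (H : ℝ) ≤ (H₁ : ℝ) * (n * (2 ^ m * M)) := by
      have hcast : (H : ℝ) = max (H₁ : ℝ) (Hn : ℝ) := by rw [hHdef]; push_cast; rfl
      rw [hcast]
      refine max_le ?_ ?_
      · exact le_mul_of_one_le_right hH₁pos.le (one_le_mul_of_one_le_of_one_le hnr h2mM)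
      · exact hHn.trans (le_mul_of_one_le_left (by positivity) hH₁1)
    calc Real.log H ≤ Real.log ((H₁ : ℝ) * (n * (2 ^ m * M))) := Real.log_le_log hHpos hHle
      _ = Real.log H₁ + Real.log n + m * Real.log 2 + Real.log M := by
        rw [Real.log_mul hH₁pos.ne' (by positivity), Real.log_mul hnpos.ne' (by positivity),
          Real.log_mul (by positivity) hMpos.ne', Real.log_pow]
        ring
  -- exponent bookkeeping
  have hna : (d : ℝ) ^ a ≤ (d : ℝ) ^ a' := Real.rpow_le_rpow_of_exponent_le hd1 (le_max_left _ _)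
  have hnb : (d : ℝ) ^ b ≤ (d : ℝ) ^ b' := Real.rpow_le_rpow_of_exponent_le hd1 (le_max_left _ _)
  have hlogH0 : 0 ≤ Real.log H := Real.log_nonneg hH1r
  have hda'0 : 0 ≤ (d : ℝ) ^ a' := by positivity
  have hLHS : C * ((d : ℝ) ^ a * Real.log H + (d : ℝ) ^ b) ≤ q₀ / 2 * m * Real.log M + K0 := by
    have step : C * (d : ℝ) ^ a' * Real.log H ≤ q₀ / 2 * m * Real.log H :=
      mul_le_mul_of_nonneg_right hda' hlogH0
    have hq2 : 0 ≤ q₀ / 2 * m := by positivity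
    calc C * ((d : ℝ) ^ a * Real.log H + (d : ℝ) ^ b)
        ≤ C * ((d : ℝ) ^ a' * Real.log H + (d : ℝ) ^ b') := by gcongr
      _ = C * (d : ℝ) ^ a' * Real.log H + C * (d : ℝ) ^ b' := by ring
      _ ≤ q₀ / 2 * m * Real.log H + C * (d : ℝ) ^ b' := by linarith
      _ ≤ q₀ / 2 * m * (Real.log H₁ + Real.log n + m * Real.log 2 + Real.log M) + C * (d : ℝ) ^ b' := by
          have := mul_le_mul_of_nonneg_left hlogH hq2
          linarith
      _ = q₀ / 2 * m * Real.log M + K0 := by rw [hK0def]; ring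
  have hKM : K0 < q₀ / 2 * m * Real.log M := by
    have hqm : 0 < q₀ / 2 * m := by positivity
    have h := mul_le_mul_of_nonneg_left hlogM hqm.le
    rw [mul_add, mul_div_cancel₀ _ hqm.ne', mul_one] at h
    linarith
  -- contradiction
  have hchain : Real.exp (-(C * ((d : ℝ) ^ a * Real.log H + (d : ℝ) ^ b))) ≤
      Real.exp (-(q₀ * m * Real.log M)) := key.trans hdist'
  rw [Real.exp_le_exp] at hchain
  linarith

/-! ## Consequences: leaf B's window is `[1/n, 1/(n−1))` at every rank; the sharp layer is false -/

/-- **Pointwise window, lower end:** at a Lindemann–Weierstrass point of rank `n ≥ 1` (algebraic,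
`ℚ`-linearly independent coordinates) every eventual approximation type has exponent `a ≥ 1/n`.
[cite: Bugeaud2004, Thm 8.11] -/
theorem approxTypeEvAt_lw_exponent_ge {n : ℕ} (hn : 1 ≤ n) (s : Fin n → ℂ)
    (halg : ∀ i, IsAlgebraic ℚ (s i)) (hli : LinearIndependent ℚ s) {a b C : ℝ}
    (h : ApproxTypeEvAt n s a b C) : 1 / (n : ℝ) ≤ a := by
  by_contra hlt
  exact stub_lwSynchronisedFloor n s a b C hn halg (fun i => hli.ne_zero i) (not_le.mp hlt) h

/-- **Leaf B's window at every rank `n`:** whatever exponent the naive Lindemann–Weierstrass layer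
`EvLW n` is proved with, at every LW point of rank `n` it lies in `[1/n, 1/(n−1))` — the lower end is
this file (Dirichlet side, unconditional), the upper end is the layer's own demand.  (`evLWDh`, p137028,
PROVES the exponent `1/n` from above in `(d, h_abs)` currency; in naive currency `1/n` is the floor.)
[cite: Bugeaud2004, Thm 8.11] -/
theorem evLW_window_rank {n : ℕ} (hn : 1 ≤ n)
    (hLW : Summit.Schanuel.Schanuel.Cruxes.KhovanskiiApproxTypeEv.RareFieldSpecies.EvLW n)
    (s : Fin n → ℂ) (halg : ∀ i, IsAlgebraic ℚ (s i)) (hli : LinearIndependent ℚ s) :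
    ∃ a b C : ℝ, 1 / (n : ℝ) ≤ a ∧ a < 1 / ((n : ℝ) - 1) ∧ ApproxTypeEvAt n s a b C := by
  obtain ⟨a, b, C, ha, hAT⟩ := hLW s halg hli
  exact ⟨a, b, C, approxTypeEvAt_lw_exponent_ge hn s halg hli hAT, ha, hAT⟩

/-- **The sharp naive LW layer `a < 1/n` is false at every rank that has an LW point** (every rank
does; an explicit witness of rank `n` is any `n` coordinates of a power basis of a number field of
degree `≥ n`): no `s ∈ ℚ̄ⁿ` with `ℚ`-linearly independent coordinates admits an eventual type with
`a < 1/n`, let alone all of them. [cite: Bugeaud2004, Thm 8.11] -/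
theorem not_evLW_sharp_of_point {n : ℕ} (hn : 1 ≤ n) (s₀ : Fin n → ℂ)
    (halg₀ : ∀ i, IsAlgebraic ℚ (s₀ i)) (hli₀ : LinearIndependent ℚ s₀) :
    ¬ (∀ s : Fin n → ℂ, (∀ i, IsAlgebraic ℚ (s i)) → LinearIndependent ℚ s →
        ∃ a b C : ℝ, a < 1 / (n : ℝ) ∧ ApproxTypeEvAt n s a b C) := by
  intro h
  obtain ⟨a, b, C, ha, hAT⟩ := h s₀ halg₀ hli₀
  exact stub_lwSynchronisedFloor n s₀ a b C hn halg₀ (fun i => hli₀.ne_zero i) ha hAT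

/-- For every `n` there are `n` algebraic numbers linearly independent over `ℚ`: the first `n` powers of a
primitive `p`-th root of unity, `p > n` prime (`[ℚ(ζ_p):ℚ] = p − 1 ≥ n`; Mathlib `linearIndependent_pow`).
So every rank has a Lindemann–Weierstrass point. [folklore] -/
theorem exists_algebraic_linearIndependent (n : ℕ) :
    ∃ s : Fin n → ℂ, (∀ i, IsAlgebraic ℚ (s i)) ∧ LinearIndependent ℚ s := by
  obtain ⟨p, hnp, hp⟩ := Nat.exists_infinite_primes (n + 1)
  set ζ : ℂ := Complex.exp (2 * Real.pi * Complex.I / p)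
  have hζ : IsPrimitiveRoot ζ p := Complex.isPrimitiveRoot_exp p hp.ne_zero
  have hint : IsIntegral ℚ ζ := (hζ.isIntegral hp.pos).tower_top
  have hdeg : (minpoly ℚ ζ).natDegree = p - 1 := by
    rw [← Polynomial.cyclotomic_eq_minpoly_rat hζ hp.pos, Polynomial.natDegree_cyclotomic,
      Nat.totient_prime hp]
  have hli := linearIndependent_pow (K := ℚ) ζ
  rw [hdeg] at hli
  have hnd : n ≤ p - 1 := by omega
  exact ⟨fun i => ζ ^ (i : ℕ), fun i => hint.isAlgebraic.pow _,
    hli.comp (Fin.castLE hnd) (Fin.castLE_injective hnd)⟩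

/-- **The sharp naive LW layer `a < 1/n` is false at EVERY rank `n ≥ 1`** (`EvLW n` with `1/(n−1)` replaced
by the generic `1/n`). [cite: Bugeaud2004, Thm 8.11] -/
theorem not_evLW_sharp {n : ℕ} (hn : 1 ≤ n) :
    ¬ (∀ s : Fin n → ℂ, (∀ i, IsAlgebraic ℚ (s i)) → LinearIndependent ℚ s →
        ∃ a b C : ℝ, a < 1 / (n : ℝ) ∧ ApproxTypeEvAt n s a b C) := by
  obtain ⟨s₀, halg₀, hli₀⟩ := exists_algebraic_linearIndependent n
  exact not_evLW_sharp_of_point hn s₀ halg₀ hli₀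

/-- **The crux with the generic exponent excluded fails AT EVERY RANK `n ≥ 1`, not only through its `n = 2`
instance** (`khovanskiiApproxTypeEv_false_sharp`, `Negative/ConjugateFloor.lean`): at rank `n` the LW point
of `exists_algebraic_linearIndependent` is a free Khovanskii point (`stub_lwPointFree`, p136499) with
`ℚ`-linearly independent coordinates and no eventual type with `a < 1/n`. [cite: Bugeaud2004, Thm 8.11] -/
theorem not_khovanskiiApproxTypeEv_sharp_rank {n : ℕ} (hn : 1 ≤ n) :
    ¬ (∀ s : Fin n → ℂ, LinearIndependent ℚ s →
        Summit.Schanuel.Schanuel.Cruxes.KhovanskiiApproxType.LwSmallHeight.IsFreeKhovanskii n s →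
        ∃ a b C : ℝ, a < 1 / (n : ℝ) ∧ ApproxTypeEvAt n s a b C) := by
  intro h
  obtain ⟨s₀, halg₀, hli₀⟩ := exists_algebraic_linearIndependent n
  obtain ⟨a, b, C, ha, hAT⟩ := h s₀ hli₀
    (Summit.Schanuel.Schanuel.Cruxes.KhovanskiiApproxTypeEv.RareFieldSpecies.stub_lwPointFree n s₀ halg₀)
  exact stub_lwSynchronisedFloor n s₀ a b C hn halg₀ (fun i => hli₀.ne_zero i) ha hAT

end Summit.Schanuel.Schanuel.Cruxes.KhovanskiiApproxTypeEv.AnchoredReduction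

end
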